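import Summits.BirchSwinnertonDyer.BirchSwinnertonDyer.Theorems.ByReductionTypeAtTwoRankOneSigmaHeightFirstOrder
import Summits.BirchSwinnertonDyer.BirchSwinnertonDyer.Theorems.EisensteinDepletionAtTwoStarGlueFinScaleLemmas
import Summits.BirchSwinnertonDyer.BirchSwinnertonDyer.Theorems.Rank2ObservatoryKrausMinimality
import HarnessLib

/-!
# The valuation of the sigma-square height at `2` on deep points: `v₂ ≥ 3`, with the equality criterion

Helpers for the route `ByReductionTypeAtTwo`, crux `RankOneAtTwoBigImageOddLocal`
(`--supports stmt-BirchSwinnertonDyer-23715`, cell bsd-f1-sign2, analytic lens, MEMO-an §50/§53 «consequences on record» made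
kernel).  For a `ℤ`-integral `V/ℚ` with `a₁ = 0`, the normalised even sigma square `Σ` at `2` and a non-singular point
`P = (x, y)` with `‖x‖₂ ≥ 2⁸`, the σ-square height `h(P) := log₂ den x − log₂ Σ(−x/y)` satisfies
(`norm_sigmaHeightTwo_add_two_mul_padicLog_le`, 50H) `‖h(P) + 2 log₂(num x/num y)‖₂ ≤ 2⁻⁸`.  Here:
* `norm_two_mul_padicLog_div_eq`: **`‖2·log₂(a/b)‖₂ = ‖a² − b²‖₂` for odd integers `a, b`** (the logarithmic series is an
  isometry on `1 + 8ℤ₂`; `8 ∣ a² − b²`; tree `DepletionAtTwo.norm_intCast_eq_one_of_odd`), hence `≤ ⅛`, and `= ⅛` iff `16 ∤ a² − b²` iff `a ≢ ±b (mod 8)`;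
* `odd_num_of_one_lt_norm`: `‖q‖₂ > 1 ⟹ num q` odd; on the curve `‖x‖₂ > 1 ⟹ num x, num y` odd;
* `norm_sigmaHeightTwo_le`: **`‖h(P)‖₂ ≤ ⅛`, i.e. `v₂ h(P) ≥ 3`**, and `norm_sigmaHeightTwo_eq_iff` /
  `norm_sigmaHeightTwo_le_iff`: **`‖h(P)‖₂ = ⅛ ⟺ 16 ∤ (num x)² − (num y)²`**, `‖h(P)‖₂ ≤ 1/16 ⟺ 16 ∣ (num x)² − (num y)²` —
  the three low bits of the `η`-height are the residues of `num x · num y (mod 8)`.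

## References
* [Mazur–Stein–Tate 2006, §1, §2.7, §4]; [Iwasawa 1972, §4.4] (the logarithm is an isometry near `1`); [Silverman AEC VII.2].
-/

namespace Summit.BirchSwinnertonDyer.BirchSwinnertonDyer.Theorems.NaiveSigmaLogAtTwo

open PowerSeries Literature Literature.NumberTheory.EllipticCurves WeierstrassCurve
open scoped Classical

/-! ## §1 The logarithm of a quotient of odd integers -/

/-- `8 ∣ a² − b²` for odd `a, b`. [folklore] -/
theorem eight_dvd_sq_sub_sq_of_odd {a b : ℤ} (ha : Odd a) (hb : Odd b) : (8 : ℤ) ∣ a ^ 2 - b ^ 2 := by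
  obtain ⟨s, rfl⟩ := ha
  obtain ⟨r, rfl⟩ := hb
  obtain ⟨c, hc⟩ := Int.even_mul_succ_self s
  obtain ⟨d, hd⟩ := Int.even_mul_succ_self r
  exact ⟨c - d, by linear_combination 4 * hc - 4 * hd⟩

/-- **`‖2·log₂(a/b)‖₂ = ‖a² − b²‖₂` for odd integers `a, b`**: `2 log₂(a/b) = log₂ y`, `y = (a/b)²`, `1 − y = −(a² − b²)/b²`
has norm `‖a² − b²‖₂ ≤ ⅛ < ‖2‖₂`, and the logarithmic series is an isometry there (tree `norm_padicLogSeries_eq`,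
`padicLog_eq_padicLogSeries`). [cite: Iwasawa1972PadicL, §4.4] -/
theorem norm_two_mul_padicLog_div_eq {a b : ℤ} (ha : Odd a) (hb : Odd b) :
    ‖2 * padicLog 2 ((a : ℚ_[2]) / (b : ℚ_[2]))‖ = ‖((a ^ 2 - b ^ 2 : ℤ) : ℚ_[2])‖ := by
  have ha1 := DepletionAtTwo.norm_intCast_eq_one_of_odd ha
  have hb1 := DepletionAtTwo.norm_intCast_eq_one_of_odd hb
  have ha0 : (a : ℚ_[2]) ≠ 0 := fun e => by rw [e, norm_zero] at ha1; exact zero_ne_one ha1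
  have hb0 : (b : ℚ_[2]) ≠ 0 := fun e => by rw [e, norm_zero] at hb1; exact zero_ne_one hb1
  set y : ℚ_[2] := ((a : ℚ_[2]) / b) ^ 2 with hy
  have h1y : 1 - y = -(((a ^ 2 - b ^ 2 : ℤ) : ℚ_[2]) / (b : ℚ_[2]) ^ 2) := by
    rw [hy]; push_cast; field_simp; ring
  have hn1y : ‖1 - y‖ = ‖((a ^ 2 - b ^ 2 : ℤ) : ℚ_[2])‖ := by
    rw [h1y, norm_neg, norm_div, norm_pow, hb1, one_pow, div_one]
  have h8 : ‖((a ^ 2 - b ^ 2 : ℤ) : ℚ_[2])‖ ≤ 8⁻¹ := by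
    have h := (Padic.norm_int_le_pow_iff_dvd (p := 2) (a ^ 2 - b ^ 2) 3).mpr
      (by have e := eight_dvd_sq_sub_sq_of_odd ha hb; norm_num; exact e)
    exact h.trans (by norm_num)
  have hy2 : ‖1 - y‖ < ‖(2 : ℚ_[2])‖ := by rw [hn1y, Rank2Observatory.padic_norm_two]; linarith
  have hy1 : ‖1 - y‖ < 1 := by rw [hn1y]; linarith
  have hlog : padicLog 2 y = 2 * padicLog 2 ((a : ℚ_[2]) / b) := by
    rw [hy, sq, padicLog_mul_holds 2 (div_ne_zero ha0 hb0) (div_ne_zero ha0 hb0), two_mul]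
  rw [← hlog, padicLog_eq_padicLogSeries hy1, norm_padicLogSeries_eq hy2, hn1y]

/-- `‖2·log₂(a/b)‖₂ ≤ ⅛` for odd `a, b`. -/
theorem norm_two_mul_padicLog_div_le {a b : ℤ} (ha : Odd a) (hb : Odd b) :
    ‖2 * padicLog 2 ((a : ℚ_[2]) / (b : ℚ_[2]))‖ ≤ 8⁻¹ := by
  rw [norm_two_mul_padicLog_div_eq ha hb]
  exact ((Padic.norm_int_le_pow_iff_dvd (p := 2) (a ^ 2 - b ^ 2) 3).mpr
    (by have e := eight_dvd_sq_sub_sq_of_odd ha hb; norm_num; exact e)).trans (by norm_num)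

/-- `‖2·log₂(a/b)‖₂ ≤ 1/16 ⟺ 16 ∣ a² − b²` for odd `a, b`. -/
theorem norm_two_mul_padicLog_div_le_iff {a b : ℤ} (ha : Odd a) (hb : Odd b) :
    ‖2 * padicLog 2 ((a : ℚ_[2]) / (b : ℚ_[2]))‖ ≤ 16⁻¹ ↔ (16 : ℤ) ∣ a ^ 2 - b ^ 2 := by
  rw [norm_two_mul_padicLog_div_eq ha hb]
  have h := Padic.norm_int_le_pow_iff_dvd (p := 2) (a ^ 2 - b ^ 2) 4
  have e1 : (((2 : ℕ) : ℝ) ^ (-((4 : ℕ) : ℤ)) : ℝ) = 16⁻¹ := by norm_num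
  have e2 : (((2 : ℕ) : ℤ) ^ 4 : ℤ) = 16 := by norm_num
  rw [e1, e2] at h
  exact h

/-- `‖2·log₂(a/b)‖₂ = ⅛ ⟺ 16 ∤ a² − b²` (`⟺ a ≢ ±b (mod 8)`) for odd `a, b`. -/
theorem norm_two_mul_padicLog_div_eq_iff {a b : ℤ} (ha : Odd a) (hb : Odd b) :
    ‖2 * padicLog 2 ((a : ℚ_[2]) / (b : ℚ_[2]))‖ = 8⁻¹ ↔ ¬ (16 : ℤ) ∣ a ^ 2 - b ^ 2 := by
  rw [← norm_two_mul_padicLog_div_le_iff ha hb, not_le]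
  refine ⟨fun h => lt_of_lt_of_eq (by norm_num) h.symm, fun h => le_antisymm (norm_two_mul_padicLog_div_le ha hb) ?_⟩
  -- norms in `ℚ₂` are powers of `2`: `> 1/16 ⟹ ≥ 1/8`
  have hne : 2 * padicLog 2 ((a : ℚ_[2]) / (b : ℚ_[2])) ≠ 0 := fun e => by rw [e, norm_zero] at h; norm_num at h
  rw [Padic.norm_eq_zpow_neg_valuation hne] at h ⊢
  have h4 : -(4 : ℤ) < -(2 * padicLog 2 ((a : ℚ_[2]) / (b : ℚ_[2]))).valuation := by
    by_contra hle
    rw [not_lt] at hle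
    have := zpow_le_zpow_right₀ (by norm_num : (1 : ℝ) ≤ 2) hle
    exact absurd (lt_of_lt_of_le h this) (by norm_num)
  calc (8⁻¹ : ℝ) = (2 : ℝ) ^ (-(3 : ℤ)) := by norm_num
    _ ≤ _ := zpow_le_zpow_right₀ (by norm_num : (1 : ℝ) ≤ 2) (by omega)

/-! ## §2 Numerators of deep points are odd -/

/-- `‖q‖₂ > 1 ⟹ num q` is odd (the denominator is even, and `num ⊥ den`). [folklore] -/
theorem odd_num_of_one_lt_norm {q : ℚ} (hq : 1 < ‖(q : ℚ_[2])‖) : Odd q.num := by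
  rw [← Int.not_even_iff_odd, even_iff_two_dvd]
  intro h2
  have hden : ¬ (2 ∣ q.den) := fun hd => by
    have hg : (2 : ℕ) ∣ Nat.gcd q.num.natAbs q.den :=
      Nat.dvd_gcd (by exact_mod_cast Int.natAbs_dvd_natAbs.mpr h2) hd
    rw [q.reduced] at hg
    omega
  have hd1 : ‖((q.den : ℤ) : ℚ_[2])‖ = 1 :=
    le_antisymm (Padic.norm_int_le_one _) (not_lt.mp fun h =>
      hden (by exact_mod_cast Padic.norm_intCast_lt_one_iff.mp h))
  have hq' : (q : ℚ_[2]) = (q.num : ℚ_[2]) / ((q.den : ℤ) : ℚ_[2]) := by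
    push_cast; exact_mod_cast (Rat.num_div_den q).symm
  rw [hq', norm_div, hd1, div_one] at hq
  exact absurd (Padic.norm_int_le_one q.num) (not_le.mpr hq)

/-- On a `ℤ`-integral curve, `‖x‖₂ > 1 ⟹ num x` and `num y` are odd (`‖y‖₂² = ‖x‖₂³ > 1`). -/
theorem odd_num_and_odd_num (V : WeierstrassCurve ℚ) [V.IsIntegral ℤ] {x y : ℚ} (h : V.toAffine.Nonsingular x y)
    (hx : 1 < ‖(x : ℚ_[2])‖) : Odd x.num ∧ Odd y.num := by
  refine ⟨odd_num_of_one_lt_norm hx, odd_num_of_one_lt_norm ?_⟩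
  have hsq := WeierstrassCurve.norm_div_sq_eq_inv_norm_of_one_lt_norm h hx
  have hX0 : (x : ℚ_[2]) ≠ 0 := fun e => by rw [e, norm_zero] at hx; linarith
  have hY0 : (y : ℚ_[2]) ≠ 0 := by
    intro e
    rw [e, div_zero, norm_zero, zero_pow two_ne_zero] at hsq
    exact (inv_ne_zero (norm_ne_zero_iff.mpr hX0)) hsq.symm
  rw [norm_div, div_pow] at hsq
  have hy2 : ‖(y : ℚ_[2])‖ ^ 2 = ‖(x : ℚ_[2])‖ ^ 3 := by
    field_simp at hsq
    linarith [hsq]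
  nlinarith [norm_nonneg (y : ℚ_[2]), hy2, hx]

/-! ## §3 The valuation law on deep points -/

/-- **`v₂ h(P) ≥ 3` on deep points**: for `ℤ`-integral `V`, `a₁ = 0`, `Σ` the normalised even sigma square with the ODE at `2`
and `‖x‖₂ ≥ 2⁸`: `‖log₂ den x − log₂ Σ(−x/y)‖₂ ≤ ⅛` (50H + `‖2 log₂(num x/num y)‖₂ ≤ ⅛`, ultrametric).
[cite: MazurSteinTate2006, §1, §4] [cite: Iwasawa1972PadicL, §4.4] -/
theorem norm_sigmaHeightTwo_le (V : WeierstrassCurve ℚ) [V.IsIntegral ℤ] {x y : ℚ} (h : V.toAffine.Nonsingular x y)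
    (ha1 : V.a₁ = 0) (Sq : ℚ_[2]⟦X⟧) (h0 : constantCoeff Sq = 0) (h1 : coeff 1 Sq = 0) (h2 : coeff 2 Sq = 1)
    (h3 : coeff 3 Sq = 0) (hODE : (V.baseChange ℚ_[2]).SatisfiesSigmaSqODE Sq 0) (hx : (256 : ℝ) ≤ ‖(x : ℚ_[2])‖) :
    ‖padicLog 2 (x.den : ℚ_[2]) - padicLog 2 (padicEval Sq (-(x : ℚ_[2]) / y))‖ ≤ 8⁻¹ := by
  have h50 := norm_sigmaHeightTwo_add_two_mul_padicLog_le V h ha1 Sq h0 h1 h2 h3 hODE hx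
  obtain ⟨hxo, hyo⟩ := odd_num_and_odd_num V h (by linarith)
  have hl := norm_two_mul_padicLog_div_le hxo hyo
  set H := padicLog 2 (x.den : ℚ_[2]) - padicLog 2 (padicEval Sq (-(x : ℚ_[2]) / y))
  set G := 2 * padicLog 2 ((x.num : ℚ_[2]) / (y.num : ℚ_[2]))
  have e : H = (H + G) + -G := by ring
  rw [e]
  refine (IsUltrametricDist.norm_add_le_max _ _).trans (max_le (h50.trans (by norm_num)) ?_)
  rwa [norm_neg]

/-- **Equality criterion**: under the same hypotheses `‖h(P)‖₂ ≤ 1/16 ⟺ 16 ∣ (num x)² − (num y)²`. -/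
theorem norm_sigmaHeightTwo_le_iff (V : WeierstrassCurve ℚ) [V.IsIntegral ℤ] {x y : ℚ} (h : V.toAffine.Nonsingular x y)
    (ha1 : V.a₁ = 0) (Sq : ℚ_[2]⟦X⟧) (h0 : constantCoeff Sq = 0) (h1 : coeff 1 Sq = 0) (h2 : coeff 2 Sq = 1)
    (h3 : coeff 3 Sq = 0) (hODE : (V.baseChange ℚ_[2]).SatisfiesSigmaSqODE Sq 0) (hx : (256 : ℝ) ≤ ‖(x : ℚ_[2])‖) :
    ‖padicLog 2 (x.den : ℚ_[2]) - padicLog 2 (padicEval Sq (-(x : ℚ_[2]) / y))‖ ≤ 16⁻¹ ↔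
      (16 : ℤ) ∣ x.num ^ 2 - y.num ^ 2 := by
  have h50 := norm_sigmaHeightTwo_add_two_mul_padicLog_le V h ha1 Sq h0 h1 h2 h3 hODE hx
  obtain ⟨hxo, hyo⟩ := odd_num_and_odd_num V h (by linarith)
  rw [← norm_two_mul_padicLog_div_le_iff hxo hyo]
  set H := padicLog 2 (x.den : ℚ_[2]) - padicLog 2 (padicEval Sq (-(x : ℚ_[2]) / y))
  set G := 2 * padicLog 2 ((x.num : ℚ_[2]) / (y.num : ℚ_[2]))
  have hsmall : ‖H + G‖ ≤ 16⁻¹ := h50.trans (by norm_num)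
  constructor
  · intro hH
    have e : G = (H + G) + -H := by ring
    rw [e]
    exact (IsUltrametricDist.norm_add_le_max _ _).trans (max_le hsmall (by rwa [norm_neg]))
  · intro hG
    have e : H = (H + G) + -G := by ring
    rw [e]
    exact (IsUltrametricDist.norm_add_le_max _ _).trans (max_le hsmall (by rwa [norm_neg]))

/-- **`v₂ h(P) = 3 ⟺ 16 ∤ (num x)² − (num y)²`** (`⟺ num x ≢ ± num y (mod 8)`) on deep points. -/
theorem norm_sigmaHeightTwo_eq_iff (V : WeierstrassCurve ℚ) [V.IsIntegral ℤ] {x y : ℚ} (h : V.toAffine.Nonsingular x y)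
    (ha1 : V.a₁ = 0) (Sq : ℚ_[2]⟦X⟧) (h0 : constantCoeff Sq = 0) (h1 : coeff 1 Sq = 0) (h2 : coeff 2 Sq = 1)
    (h3 : coeff 3 Sq = 0) (hODE : (V.baseChange ℚ_[2]).SatisfiesSigmaSqODE Sq 0) (hx : (256 : ℝ) ≤ ‖(x : ℚ_[2])‖) :
    ‖padicLog 2 (x.den : ℚ_[2]) - padicLog 2 (padicEval Sq (-(x : ℚ_[2]) / y))‖ = 8⁻¹ ↔
      ¬ (16 : ℤ) ∣ x.num ^ 2 - y.num ^ 2 := by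
  have h50 := norm_sigmaHeightTwo_add_two_mul_padicLog_le V h ha1 Sq h0 h1 h2 h3 hODE hx
  obtain ⟨hxo, hyo⟩ := odd_num_and_odd_num V h (by linarith)
  rw [← norm_two_mul_padicLog_div_eq_iff hxo hyo]
  set H := padicLog 2 (x.den : ℚ_[2]) - padicLog 2 (padicEval Sq (-(x : ℚ_[2]) / y))
  set G := 2 * padicLog 2 ((x.num : ℚ_[2]) / (y.num : ℚ_[2]))
  have hsmall : ‖H + G‖ < 8⁻¹ := lt_of_le_of_lt h50 (by norm_num)
  -- `‖H − (−G)‖ < ‖−G‖`-type equality of norms in an ultrametric space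
  have key : ∀ {A B : ℚ_[2]}, ‖A + B‖ < 8⁻¹ → ‖B‖ = 8⁻¹ → ‖A‖ = 8⁻¹ := by
    intro A B hAB hB
    have e : A = (A + B) + -B := by ring
    have hne : ‖A + B‖ ≠ ‖-B‖ := by rw [norm_neg, hB]; exact hAB.ne
    rw [e, Padic.add_eq_max_of_ne hne, norm_neg, hB, max_eq_right hAB.le]
  constructor
  · intro hH
    exact key (by rwa [add_comm]) hH
  · intro hG
    exact key hsmall hG

end Summit.BirchSwinnertonDyer.BirchSwinnertonDyer.Theorems.NaiveSigmaLogAtTwo
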